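import Summits.QuantumFields.YangMills.Theorems.UniversalDetectorLatticeRiemannQ2Template
import Summits.QuantumFields.YangMills.Theorems.UniversalDetectorBlindLatticeExtraction

/-!
# Route `UniversalDetector`, LINE «blind detector» (item stmt-QuantumFields-24148 `BlindDetector`, stub
# `BlindSeqExtraction`): hyperplane cutoffs — the coordinate hyperplanes carry no Schwartz-weighted mass

Fleet lead `ym-spine-19353-p1` g26 (crux `BalabanLadder.NT`, LINE g11-1 of ym-idea-8).  The blind limit kernel is
continuous only on `Ω = {∀ i, zᵢ ≠ 0}` and the lattice kernels converge to it only on orthant annuli; the last two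
clauses of `BlindSeqExtraction` (slab reflection positivity, `Q2 → ∫∫ w₁ w₂ K`) are reached by CUTTING OFF the
coordinate hyperplanes and letting the cutoff go:

* `exists_cutoff` — for `η > 0` a continuous `χ : ℝ⁴ → [0,1]`, `= 1` on `{∀ i, 2η ≤ |zᵢ|}`, `= 0` on `{∃ i, |zᵢ| ≤ η}`;
  `continuous_cutoff_mul` — `χ · K` is continuous on all of `ℝ⁴` when `K` is continuous on `Ω`;
* `volume_coordHyperplane`, `prod_volume_hyperplaneDiff` — coordinate hyperplanes (and the set of pairs whose
  difference lies on one) are Lebesgue-null;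
* `tendsto_integral_cutoffDefect` — `J_n = ∫∫ |w₁(u)| |w₂(v)| (1 − χ_n(v − u)) → 0` when `χ_n → 1` pointwise on `Ω`
  (dominated convergence off a null set); `tendsto_latticeSum_cutoffDefect` — the lattice sums
  `s⁸ Σ |w₁(s x)| |w₂(s x')| (1 − χ(s x' − s x))` converge to the same integral (tree `tendsto_latticeRiemannSum₂`);
* `tendsto_of_forall_approx` — a sequence that is, for every `δ`, eventually `δ`-close to a sequence converging
  `δ`-close to `I` converges to `I`.

Pure analysis; no summit, rung or crux statement is proved here. [folklore]
-/

set_option autoImplicit false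

noncomputable section

namespace Summit.QuantumFields.YangMills.Cruxes.UniversalDetectorBlindExtraction

open MeasureTheory Filter Topology Finset
open Literature.MathematicalPhysics.QuantumLattice (siteToE siteToE_apply)
open Literature.Probability.LatticeModels (Site box mem_box)
open Summit.QuantumFields.YangMills.Cruxes.UniversalDetectorLimitExtraction (tendsto_latticeRiemannSum₂)

/-! ### Cutoffs of the coordinate hyperplanes -/

/-- **Hyperplane cutoff.**  For `η > 0` there is a continuous `χ : ℝ⁴ → [0, 1]` with `χ = 1` on
`{∀ i, 2η ≤ |zᵢ|}` and `χ = 0` on `{∃ i, |zᵢ| ≤ η}` (a product of four piecewise-linear profiles). [folklore] -/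
theorem exists_cutoff {η : ℝ} (hη : 0 < η) :
    ∃ χ : EuclideanSpace ℝ (Fin 4) → ℝ, Continuous χ ∧ (∀ z, 0 ≤ χ z) ∧ (∀ z, χ z ≤ 1) ∧
      (∀ z : EuclideanSpace ℝ (Fin 4), (∀ i : Fin 4, 2 * η ≤ |z i|) → χ z = 1) ∧
      (∀ (z : EuclideanSpace ℝ (Fin 4)) (i : Fin 4), |z i| ≤ η → χ z = 0) := by
  refine ⟨fun z => ∏ i : Fin 4, max 0 (min 1 ((|z i| - η) / η)), ?_, ?_, ?_, ?_, ?_⟩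
  · refine continuous_finsetProd _ fun i _ => continuous_const.max (continuous_const.min ?_)
    exact ((continuous_abs.comp (PiLp.continuous_apply 2 _ i)).sub continuous_const).div_const _
  · intro z; exact prod_nonneg fun i _ => le_max_left _ _
  · intro z
    exact prod_le_one (fun i _ => le_max_left _ _) fun i _ => max_le zero_le_one (min_le_left _ _)
  · intro z hz
    refine prod_eq_one fun i _ => ?_
    have h1 : 1 ≤ (|z i| - η) / η := by rw [le_div_iff₀ hη]; linarith [hz i]
    rw [min_eq_left h1, max_eq_right zero_le_one]
  · intro z i hi
    refine prod_eq_zero (mem_univ i) ?_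
    have h1 : (|z i| - η) / η ≤ 0 := div_nonpos_of_nonpos_of_nonneg (by linarith) hη.le
    exact le_antisymm (max_le le_rfl ((min_le_right _ _).trans h1)) (le_max_left _ _)

/-- **A cutoff times a kernel continuous on `Ω` is continuous everywhere.** [folklore] -/
theorem continuous_cutoff_mul (K : EuclideanSpace ℝ (Fin 4) → ℝ)
    (hK : ContinuousOn K {z | ∀ i : Fin 4, z i ≠ 0}) (χ : EuclideanSpace ℝ (Fin 4) → ℝ) (hχ : Continuous χ)
    {η : ℝ} (hη : 0 < η) (hχ0 : ∀ (z : EuclideanSpace ℝ (Fin 4)) (i : Fin 4), |z i| ≤ η → χ z = 0) :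
    Continuous fun z => χ z * K z := by
  refine continuous_iff_continuousAt.2 fun p => ?_
  by_cases hp : ∀ i : Fin 4, p i ≠ 0
  · exact hχ.continuousAt.mul (hK.continuousAt (isOpen_forall_coord_ne_zero.mem_nhds hp))
  · push Not at hp
    obtain ⟨i, hi⟩ := hp
    have hV : IsOpen {z : EuclideanSpace ℝ (Fin 4) | |z i| < η} :=
      isOpen_lt (continuous_abs.comp (PiLp.continuous_apply 2 _ i)) continuous_const
    have hpV : p ∈ {z : EuclideanSpace ℝ (Fin 4) | |z i| < η} := by
      simp only [Set.mem_setOf_eq, hi, abs_zero]; exact hη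
    refine (continuousAt_const (y := (0 : ℝ))).congr ?_
    filter_upwards [hV.mem_nhds hpV] with z hz
    rw [hχ0 z i (le_of_lt hz), zero_mul]

/-! ### The coordinate hyperplanes are null -/

/-- A coordinate hyperplane of `ℝ⁴` is Lebesgue-null. [folklore] -/
theorem volume_coordHyperplane (i : Fin 4) (c : ℝ) :
    volume {y : EuclideanSpace ℝ (Fin 4) | y i = c} = 0 := by
  have hS : MeasurableSet {f : Fin 4 → ℝ | f i = c} :=
    measurableSet_eq_fun (measurable_pi_apply i) measurable_const
  have h := (PiLp.volume_preserving_ofLp (Fin 4)).measure_preimage hS.nullMeasurableSet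
  have hset : (WithLp.ofLp : EuclideanSpace ℝ (Fin 4) → (Fin 4 → ℝ)) ⁻¹' {f : Fin 4 → ℝ | f i = c} =
      {y : EuclideanSpace ℝ (Fin 4) | y i = c} := by
    ext y; simp
  rw [hset] at h
  rw [h, volume_pi]
  exact Measure.pi_hyperplane (fun _ : Fin 4 => (volume : Measure ℝ)) i c

/-- For every `x`, the set of `y` with `y − x` on a coordinate hyperplane is null. [folklore] -/
theorem volume_hyperplaneDiff_section (x : EuclideanSpace ℝ (Fin 4)) :
    volume {y : EuclideanSpace ℝ (Fin 4) | ∃ i : Fin 4, (y - x) i = 0} = 0 := by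
  have h : {y : EuclideanSpace ℝ (Fin 4) | ∃ i : Fin 4, (y - x) i = 0} = ⋃ i : Fin 4, {y | y i = x i} := by
    ext y
    simp only [Set.mem_setOf_eq, Set.mem_iUnion, PiLp.sub_apply, sub_eq_zero]
  rw [h]
  exact measure_iUnion_null fun i => volume_coordHyperplane i (x i)

/-- The set of pairs whose difference lies on a coordinate hyperplane is null for the product measure.
[folklore] -/
theorem prod_volume_hyperplaneDiff :
    (volume.prod volume : Measure (EuclideanSpace ℝ (Fin 4) × EuclideanSpace ℝ (Fin 4)))
      {z | ∃ i : Fin 4, (z.2 - z.1) i = 0} = 0 := by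
  have hmeas : MeasurableSet {z : EuclideanSpace ℝ (Fin 4) × EuclideanSpace ℝ (Fin 4) |
      ∃ i : Fin 4, (z.2 - z.1) i = 0} := by
    have h : {z : EuclideanSpace ℝ (Fin 4) × EuclideanSpace ℝ (Fin 4) | ∃ i : Fin 4, (z.2 - z.1) i = 0} =
        ⋃ i : Fin 4, {z | (z.2 - z.1) i = 0} := by
      ext z; simp
    rw [h]
    refine MeasurableSet.iUnion fun i => ?_
    exact (isClosed_eq ((PiLp.continuous_apply 2 _ i).comp (continuous_snd.sub continuous_fst))
      continuous_const).measurableSet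
  rw [Measure.measure_prod_null hmeas]
  refine Filter.Eventually.of_forall fun x => ?_
  have h : Prod.mk x ⁻¹' {z : EuclideanSpace ℝ (Fin 4) × EuclideanSpace ℝ (Fin 4) | ∃ i : Fin 4, (z.2 - z.1) i = 0} =
      {y : EuclideanSpace ℝ (Fin 4) | ∃ i : Fin 4, (y - x) i = 0} := by
    ext y; simp
  simp only [Pi.zero_apply, h]
  exact volume_hyperplaneDiff_section x

/-! ### The cutoff defect carries no mass -/

/-- Polynomial decay of a Schwartz function: `|w u| ≤ C / (1 + ‖u‖)^k`. [folklore] -/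
private lemma schwartz_decay_aux (w : SchwartzMap (EuclideanSpace ℝ (Fin 4)) ℝ) (k : ℕ) :
    ∃ C : ℝ, 0 ≤ C ∧ ∀ u : EuclideanSpace ℝ (Fin 4), |w u| ≤ C * ((1 + ‖u‖) ^ k)⁻¹ := by
  refine ⟨2 ^ k * (Finset.Iic (k, 0)).sup (fun m => SchwartzMap.seminorm ℝ m.1 m.2) w, by positivity,
    fun u => ?_⟩
  have h := SchwartzMap.one_add_le_sup_seminorm_apply (𝕜 := ℝ) (m := (k, 0)) le_rfl le_rfl w u
  rw [norm_iteratedFDeriv_zero, Real.norm_eq_abs] at h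
  have hpos : 0 < (1 + ‖u‖) ^ k := by positivity
  rw [← div_eq_mul_inv, le_div_iff₀ hpos, mul_comm]
  exact h

/-- The product Schwartz weight `|w₁(u)| |w₂(v)|` is integrable on `ℝ⁴ × ℝ⁴`. [folklore] -/
theorem integrable_absWeight_prod (w₁ w₂ : SchwartzMap (EuclideanSpace ℝ (Fin 4)) ℝ) :
    Integrable (fun z : EuclideanSpace ℝ (Fin 4) × EuclideanSpace ℝ (Fin 4) => |w₁ z.1| * |w₂ z.2|)
      (volume.prod volume) := by
  have h1 : Integrable (fun u : EuclideanSpace ℝ (Fin 4) => |w₁ u|) volume := w₁.integrable.abs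
  have h2 : Integrable (fun v : EuclideanSpace ℝ (Fin 4) => |w₂ v|) volume := w₂.integrable.abs
  exact h1.mul_prod h2

/-- **The cutoff defect carries no Schwartz-weighted mass in the limit.**  If continuous cutoffs `χ_n : ℝ⁴ → [0,1]`
become eventually `1` at every point of `Ω`, then `∫∫ |w₁(u)| |w₂(v)| (1 − χ_n(v − u)) → 0`. [folklore] -/
theorem tendsto_integral_cutoffDefect (w₁ w₂ : SchwartzMap (EuclideanSpace ℝ (Fin 4)) ℝ)
    (χ : ℕ → EuclideanSpace ℝ (Fin 4) → ℝ) (hχc : ∀ n, Continuous (χ n))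
    (hχ0 : ∀ n z, 0 ≤ χ n z) (hχ1 : ∀ n z, χ n z ≤ 1)
    (hχΩ : ∀ z : EuclideanSpace ℝ (Fin 4), (∀ i : Fin 4, z i ≠ 0) → ∀ᶠ n in atTop, χ n z = 1) :
    Tendsto (fun n => ∫ z : EuclideanSpace ℝ (Fin 4) × EuclideanSpace ℝ (Fin 4),
        |w₁ z.1| * |w₂ z.2| * (1 - χ n (z.2 - z.1)) ∂(volume.prod volume)) atTop (𝓝 0) := by
  have hF := integrable_absWeight_prod w₁ w₂
  have hlim : Tendsto (fun n => ∫ z : EuclideanSpace ℝ (Fin 4) × EuclideanSpace ℝ (Fin 4),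
      |w₁ z.1| * |w₂ z.2| * (1 - χ n (z.2 - z.1)) ∂(volume.prod volume)) atTop
      (𝓝 (∫ z : EuclideanSpace ℝ (Fin 4) × EuclideanSpace ℝ (Fin 4), (0 : ℝ) ∂(volume.prod volume))) := by
    refine tendsto_integral_of_dominated_convergence (fun z => |w₁ z.1| * |w₂ z.2|) (fun n => ?_) hF
      (fun n => Filter.Eventually.of_forall fun z => ?_) ?_
    · have hc : Continuous fun z : EuclideanSpace ℝ (Fin 4) × EuclideanSpace ℝ (Fin 4) =>
          |w₁ z.1| * |w₂ z.2| * (1 - χ n (z.2 - z.1)) :=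
        ((continuous_abs.comp (w₁.continuous.comp continuous_fst)).mul
          (continuous_abs.comp (w₂.continuous.comp continuous_snd))).mul
          (continuous_const.sub ((hχc n).comp (continuous_snd.sub continuous_fst)))
      exact hc.aestronglyMeasurable
    · have h0 : 0 ≤ 1 - χ n (z.2 - z.1) := by linarith [hχ1 n (z.2 - z.1)]
      have h1 : 1 - χ n (z.2 - z.1) ≤ 1 := by linarith [hχ0 n (z.2 - z.1)]
      have hw : 0 ≤ |w₁ z.1| * |w₂ z.2| := mul_nonneg (abs_nonneg _) (abs_nonneg _)
      rw [Real.norm_eq_abs, abs_of_nonneg (mul_nonneg hw h0)]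
      exact mul_le_of_le_one_right hw h1
    · have hae : ∀ᵐ z : EuclideanSpace ℝ (Fin 4) × EuclideanSpace ℝ (Fin 4) ∂(volume.prod volume),
          z ∉ {z | ∃ i : Fin 4, (z.2 - z.1) i = 0} :=
        measure_eq_zero_iff_ae_notMem.1 prod_volume_hyperplaneDiff
      filter_upwards [hae] with z hz
      have hz' : ∀ i : Fin 4, (z.2 - z.1) i ≠ 0 := by
        intro i h0; exact hz ⟨i, h0⟩
      refine (tendsto_const_nhds (x := (0 : ℝ))).congr' ?_
      filter_upwards [hχΩ (z.2 - z.1) hz'] with n hn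
      rw [hn, sub_self, mul_zero]
  rwa [integral_zero] at hlim

/-- **Lattice side: the cutoff-defect sums converge to the cutoff-defect integral.** [folklore] -/
theorem tendsto_latticeSum_cutoffDefect (w₁ w₂ : SchwartzMap (EuclideanSpace ℝ (Fin 4)) ℝ)
    (χ : EuclideanSpace ℝ (Fin 4) → ℝ) (hχc : Continuous χ) (hχ0 : ∀ z, 0 ≤ χ z) (hχ1 : ∀ z, χ z ≤ 1)
    (s : ℕ → ℝ) (hs : ∀ k, 0 < s k) (hs0 : Tendsto s atTop (𝓝 0))
    (L : ℕ → ℕ) (hL : Tendsto (fun k => s k * L k) atTop atTop) :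
    Tendsto (fun k => (s k ^ 4) ^ 2 * ∑ x ∈ box 4 (L k), ∑ x' ∈ box 4 (L k),
        |w₁ (s k • siteToE x)| * |w₂ (s k • siteToE x')| * (1 - χ (s k • siteToE x' - s k • siteToE x))) atTop
      (𝓝 (∫ z : EuclideanSpace ℝ (Fin 4) × EuclideanSpace ℝ (Fin 4),
        |w₁ z.1| * |w₂ z.2| * (1 - χ (z.2 - z.1)) ∂(volume.prod volume))) := by
  obtain ⟨C₁, hC₁0, hC₁⟩ := schwartz_decay_aux w₁ 5
  obtain ⟨C₂, hC₂0, hC₂⟩ := schwartz_decay_aux w₂ 5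
  have hcont : Continuous fun z : EuclideanSpace ℝ (Fin 4) × EuclideanSpace ℝ (Fin 4) =>
      |w₁ z.1| * |w₂ z.2| * (1 - χ (z.2 - z.1)) :=
    ((continuous_abs.comp (w₁.continuous.comp continuous_fst)).mul
      (continuous_abs.comp (w₂.continuous.comp continuous_snd))).mul
      (continuous_const.sub (hχc.comp (continuous_snd.sub continuous_fst)))
  have hdom : ∀ u v : EuclideanSpace ℝ (Fin 4), |(|w₁ u| * |w₂ v| * (1 - χ (v - u)))| ≤
      C₁ * C₂ * ((1 + ‖u‖) ^ 5)⁻¹ * ((1 + ‖v‖) ^ 5)⁻¹ := by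
    intro u v
    have h01 : 0 ≤ 1 - χ (v - u) ∧ 1 - χ (v - u) ≤ 1 := ⟨by linarith [hχ1 (v - u)], by linarith [hχ0 (v - u)]⟩
    rw [abs_of_nonneg (by have := h01.1; positivity)]
    calc |w₁ u| * |w₂ v| * (1 - χ (v - u)) ≤ |w₁ u| * |w₂ v| * 1 :=
          mul_le_mul_of_nonneg_left h01.2 (by positivity)
      _ ≤ (C₁ * ((1 + ‖u‖) ^ 5)⁻¹) * (C₂ * ((1 + ‖v‖) ^ 5)⁻¹) * 1 :=
          mul_le_mul_of_nonneg_right (mul_le_mul (hC₁ u) (hC₂ v) (abs_nonneg _)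
            (mul_nonneg hC₁0 (by positivity))) zero_le_one
      _ = C₁ * C₂ * ((1 + ‖u‖) ^ 5)⁻¹ * ((1 + ‖v‖) ^ 5)⁻¹ := by ring
  have h := tendsto_latticeRiemannSum₂ (fun u v => |w₁ u| * |w₂ v| * (1 - χ (v - u))) hcont
    (by norm_num : 4 < 5) hdom s hs hs0 L hL
  rwa [Measure.volume_eq_prod] at h

/-! ### Approximate limits -/

/-- **Approximate limits.**  If for every `δ > 0` the sequence `u` is eventually `δ`-close to a sequence
converging to a point `δ`-close to `I`, then `u → I`. [folklore] -/
theorem tendsto_of_forall_approx (u : ℕ → ℝ) (I : ℝ)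
    (h : ∀ δ : ℝ, 0 < δ → ∃ (v : ℕ → ℝ) (J : ℝ), Tendsto v atTop (𝓝 J) ∧ |J - I| ≤ δ ∧
      ∀ᶠ k in atTop, |u k - v k| ≤ δ) :
    Tendsto u atTop (𝓝 I) := by
  rw [Metric.tendsto_nhds]
  intro ε hε
  obtain ⟨v, J, hv, hJ, huv⟩ := h (ε / 3) (by positivity)
  have hv' : ∀ᶠ k in atTop, |v k - J| < ε / 3 := by
    have := (Metric.tendsto_nhds.mp hv) (ε / 3) (by positivity)
    exact this.mono fun k hk => by rwa [Real.dist_eq] at hk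
  filter_upwards [huv, hv'] with k h1 h2
  rw [Real.dist_eq]
  calc |u k - I| = |(u k - v k) + (v k - J) + (J - I)| := by ring_nf
    _ ≤ |u k - v k| + |v k - J| + |J - I| := abs_add_three _ _ _
    _ < ε := by linarith

end Summit.QuantumFields.YangMills.Cruxes.UniversalDetectorBlindExtraction

end
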